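import Literature.NumberTheory.DiophantineGeometry.SUnitMordellHeightBoundsModularity
import Mathlib.NumberTheory.Padics.PadicVal.Basic
import HarnessLib

/-!
# `S`-units of `ℚ` modulo cubes: `y = ε · w³` with `h(ε) ≤ log N_S` (proofs)

Topic `Literature/NumberTheory/DiophantineGeometry` (family `abc`). Theorems only — NO definition, NO new named
fact (D-0014, D-0026). The elementary step *"We write `y = ε y'³` with `y' ∈ 𝒪^×` and `ε ∈ ℤ_{≥1}` dividing
`N_S²`"* of the proof of Cor. 9.1 of R. von Känel, B. Matschke, arXiv:1605.06079 = Mem. AMS 286 (2023)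
[`VonkanelMatschke2023`], §9 — here with the symmetric choice of exponents `r_p ∈ {−1, 0, 1}`
(`ε = ∏_{p ∈ S} p^{r_p} ∈ 𝒪^×`, so that `h(ε) ≤ log N_S` rather than `≤ 2 log N_S`), which is what the
printed constant `8 log N_S` of Cor. 9.1 requires (see `RamanujanNagellHeightBoundProofs.lean`).

## What is proved here (valuation-theoretic description of `𝒪^× = ℤ[1/N_S]^×`)

* `padicValRat_eq_zero_of_isSUnit`, `isSUnit_of_padicValRat_eq_zero` — `x ∈ 𝒪^×` iff `x ≠ 0` and
  `ord_p(x) = 0` for every prime `p ∉ S`.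
* `padicValRat_prod_natCast_zpow` — `ord_p(∏_{ℓ ∈ S} ℓ^{q_ℓ}) = q_p` (`p ∈ S`), `= 0` (`p ∉ S`).
* `natAbs_num_dvd_primesProd`, `den_dvd_primesProd` — if `ord_p(ε) = 0` off `S` and `|ord_p(ε)| ≤ 1` on
  `S`, then numerator and denominator of `ε` divide `N_S`; hence `h(ε) ≤ log N_S`.
* `exists_eq_mul_cube_of_isSUnit` — every `y ∈ 𝒪^×` is `ε · w³` with `ε, w ∈ 𝒪^×`, `h(ε) ≤ log N_S`.

[cite: VonkanelMatschke2023, §9 (proof of Cor. 9.1: y = ε y'³)]. No `abc` claim; axioms standard.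
-/

noncomputable section

open Height

namespace Literature.NumberTheory.DiophantineGeometry

namespace VonKanelMatschke

/-! ### `𝒪^×` through `p`-adic valuations -/

/-- For `x ∈ 𝒪^× = ℤ[1/N_S]^×` and a prime `p ∉ S`: `ord_p(x) = 0`.
[cite: VonkanelMatschke2023, §1 (eq:sunit) (𝒪^×)] -/
theorem padicValRat_eq_zero_of_isSUnit {S : Finset ℕ} {x : ℚ} (hx : IsSUnit S x) {p : ℕ}
    (hp : p.Prime) (hpS : p ∉ S) : padicValRat p x = 0 := by
  obtain ⟨hx0, hnum, hden⟩ := hx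
  have h1 : ¬ p ∣ x.num.natAbs := fun h =>
    hpS (hnum (Nat.mem_primeFactors.mpr ⟨hp, h, Int.natAbs_ne_zero.mpr (Rat.num_ne_zero.mpr hx0)⟩))
  have h2 : ¬ p ∣ x.den := fun h => hpS (hden (Nat.mem_primeFactors.mpr ⟨hp, h, x.den_nz⟩))
  rw [padicValRat_def, padicValInt, padicValNat.eq_zero_of_not_dvd h1, padicValNat.eq_zero_of_not_dvd h2]
  simp

/-- Conversely, a nonzero rational with `ord_p(x) = 0` for all primes `p ∉ S` lies in `𝒪^×`.
[cite: VonkanelMatschke2023, §1 (eq:sunit) (𝒪^×)] -/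
theorem isSUnit_of_padicValRat_eq_zero {S : Finset ℕ} {x : ℚ} (hx0 : x ≠ 0)
    (h : ∀ p : ℕ, p.Prime → p ∉ S → padicValRat p x = 0) : IsSUnit S x := by
  have hnum0 : x.num.natAbs ≠ 0 := Int.natAbs_ne_zero.mpr (Rat.num_ne_zero.mpr hx0)
  have hcop : Nat.Coprime x.num.natAbs x.den := x.reduced
  refine ⟨hx0, fun p hp => ?_, fun p hp => ?_⟩
  · obtain ⟨hpP, hpd, -⟩ := Nat.mem_primeFactors.mp hp
    by_contra hpS
    haveI : Fact p.Prime := ⟨hpP⟩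
    have h1 := h p hpP hpS
    have hnd : ¬ p ∣ x.den := fun hd =>
      hpP.one_lt.ne' (Nat.eq_one_of_dvd_one (hcop ▸ Nat.dvd_gcd hpd hd))
    have h2 : 1 ≤ padicValNat p x.num.natAbs := one_le_padicValNat_of_dvd hnum0 hpd
    rw [padicValRat_def, padicValInt, padicValNat.eq_zero_of_not_dvd hnd, Nat.cast_zero, sub_zero,
      Nat.cast_eq_zero] at h1
    omega
  · obtain ⟨hpP, hpd, -⟩ := Nat.mem_primeFactors.mp hp
    by_contra hpS
    haveI : Fact p.Prime := ⟨hpP⟩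
    have h1 := h p hpP hpS
    have hnn : ¬ p ∣ x.num.natAbs := fun hn =>
      hpP.one_lt.ne' (Nat.eq_one_of_dvd_one (hcop ▸ Nat.dvd_gcd hn hpd))
    have h2 : 1 ≤ padicValNat p x.den := one_le_padicValNat_of_dvd x.den_nz hpd
    rw [padicValRat_def, padicValInt, padicValNat.eq_zero_of_not_dvd hnn, Nat.cast_zero, zero_sub,
      neg_eq_zero, Nat.cast_eq_zero] at h1
    omega

/-- `ord_p` of a product of prime powers `∏_{ℓ ∈ S} ℓ^{q_ℓ}` (`q_ℓ ∈ ℤ`): `q_p` if `p ∈ S`, else `0`.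
[cite: VonkanelMatschke2023, §9 (proof of Cor. 9.1: y = ε y'³)] -/
theorem padicValRat_prod_natCast_zpow {S : Finset ℕ} (hS : ∀ ℓ ∈ S, ℓ.Prime) (q : ℕ → ℤ)
    (p : ℕ) [hp : Fact p.Prime] :
    padicValRat p (∏ ℓ ∈ S, (ℓ : ℚ) ^ q ℓ) = if p ∈ S then q p else 0 := by
  classical
  induction S using Finset.induction_on with
  | empty => simp
  | @insert ℓ T hℓT ih =>
    have hS' : ∀ ℓ ∈ T, ℓ.Prime := fun x hx => hS x (Finset.mem_insert_of_mem hx)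
    have hℓ : ℓ.Prime := hS ℓ (Finset.mem_insert_self ℓ T)
    have hne1 : (ℓ : ℚ) ^ q ℓ ≠ 0 := zpow_ne_zero _ (by exact_mod_cast hℓ.ne_zero)
    have hne2 : ∏ x ∈ T, (x : ℚ) ^ q x ≠ 0 :=
      Finset.prod_ne_zero_iff.mpr fun x hx => zpow_ne_zero _ (by exact_mod_cast (hS' x hx).ne_zero)
    rw [Finset.prod_insert hℓT, padicValRat.mul hne1 hne2, ih hS', padicValRat.zpow,
      padicValRat.of_nat]
    by_cases hpl : p = ℓ
    · subst hpl
      simp [padicValNat_self, hℓT]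
    · haveI : Fact ℓ.Prime := ⟨hℓ⟩
      rw [padicValNat_primes hpl]
      simp [Finset.mem_insert, hpl]

/-! ### Numerator and denominator of an `𝒪^×`-element with `|ord_p| ≤ 1` -/

/-- A nonzero natural number with prime factors in `P` is `∏_{ℓ ∈ P} ℓ^{v_ℓ}`. [folklore] -/
private theorem nat_eq_prod_pow_factorization' {P : Finset ℕ} {n : ℕ} (hn : n ≠ 0)
    (h : n.primeFactors ⊆ P) : n = ∏ ℓ ∈ P, ℓ ^ n.factorization ℓ := by
  rw [← Finsupp.prod_of_support_subset n.factorization (s := P)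
    (by rwa [Nat.support_factorization]) (fun p k => p ^ k) (fun _ _ => pow_zero _)]
  exact (Nat.prod_factorization_pow_eq_self hn).symm

/-- If `ε ∈ 𝒪^×` has `ord_p(ε) ≤ 1` for all `p ∈ S`, then `|num ε| ∣ N_S`.
[cite: VonkanelMatschke2023, §9 (proof of Cor. 9.1: ε ∣ N_S²), symmetric variant] -/
theorem natAbs_num_dvd_primesProd {S : Finset ℕ} (hS : ∀ p ∈ S, p.Prime) {ε : ℚ} (hε : IsSUnit S ε)
    (h1 : ∀ p ∈ S, padicValRat p ε ≤ 1) : ε.num.natAbs ∣ primesProd S := by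
  have hnum0 : ε.num.natAbs ≠ 0 := Int.natAbs_ne_zero.mpr (Rat.num_ne_zero.mpr hε.1)
  rw [nat_eq_prod_pow_factorization' hnum0 hε.2.1, primesProd]
  refine Finset.prod_dvd_prod_of_dvd _ _ fun p hp => ?_
  have hpP := hS p hp
  haveI : Fact p.Prime := ⟨hpP⟩
  have hle : ε.num.natAbs.factorization p ≤ 1 := by
    rw [Nat.factorization_def _ hpP]
    by_cases hd : p ∣ ε.num.natAbs
    · have hnd : ¬ p ∣ ε.den := fun hd' =>
        hpP.one_lt.ne' (Nat.eq_one_of_dvd_one (ε.reduced ▸ Nat.dvd_gcd hd hd'))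
      have h2 := h1 p hp
      rw [padicValRat_def, padicValInt, padicValNat.eq_zero_of_not_dvd hnd, Nat.cast_zero, sub_zero] at h2
      exact_mod_cast h2
    · rw [padicValNat.eq_zero_of_not_dvd hd]; exact Nat.zero_le 1
  calc p ^ ε.num.natAbs.factorization p ∣ p ^ 1 := pow_dvd_pow p hle
    _ = p := pow_one p

/-- If `ε ∈ 𝒪^×` has `ord_p(ε) ≥ −1` for all `p ∈ S`, then `den ε ∣ N_S`.
[cite: VonkanelMatschke2023, §9 (proof of Cor. 9.1: ε ∣ N_S²), symmetric variant] -/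
theorem den_dvd_primesProd {S : Finset ℕ} (hS : ∀ p ∈ S, p.Prime) {ε : ℚ} (hε : IsSUnit S ε)
    (h1 : ∀ p ∈ S, -1 ≤ padicValRat p ε) : ε.den ∣ primesProd S := by
  rw [nat_eq_prod_pow_factorization' ε.den_nz hε.2.2, primesProd]
  refine Finset.prod_dvd_prod_of_dvd _ _ fun p hp => ?_
  have hpP := hS p hp
  haveI : Fact p.Prime := ⟨hpP⟩
  have hle : ε.den.factorization p ≤ 1 := by
    rw [Nat.factorization_def _ hpP]
    by_cases hd : p ∣ ε.den
    · have hnn : ¬ p ∣ ε.num.natAbs := fun hn =>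
        hpP.one_lt.ne' (Nat.eq_one_of_dvd_one (ε.reduced ▸ Nat.dvd_gcd hn hd))
      have h2 := h1 p hp
      rw [padicValRat_def, padicValInt, padicValNat.eq_zero_of_not_dvd hnn, Nat.cast_zero, zero_sub,
        neg_le_neg_iff] at h2
      exact_mod_cast h2
    · rw [padicValNat.eq_zero_of_not_dvd hd]; exact Nat.zero_le 1
  calc p ^ ε.den.factorization p ∣ p ^ 1 := pow_dvd_pow p hle
    _ = p := pow_one p

/-- Hence `h(ε) ≤ log N_S` for such `ε`. [cite: VonkanelMatschke2023, §9 (proof of Cor. 9.1), symmetric variant] -/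
theorem logHeight₁_le_log_primesProd {S : Finset ℕ} (hS : ∀ p ∈ S, p.Prime) {ε : ℚ} (hε : IsSUnit S ε)
    (h1 : ∀ p ∈ S, padicValRat p ε ≤ 1) (h2 : ∀ p ∈ S, -1 ≤ padicValRat p ε) :
    logHeight₁ ε ≤ Real.log (primesProd S) := by
  have hN := one_le_primesProd hS
  have hnum : ε.num.natAbs ≤ primesProd S := Nat.le_of_dvd (by omega) (natAbs_num_dvd_primesProd hS hε h1)
  have hden : ε.den ≤ primesProd S := Nat.le_of_dvd (by omega) (den_dvd_primesProd hS hε h2)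
  rw [Rat.logHeight₁_eq_log_max]
  have hmax : ((max ε.num.natAbs ε.den : ℕ) : ℝ) ≤ (primesProd S : ℝ) := by
    exact_mod_cast max_le hnum hden
  have hpos : (0 : ℝ) < ((max ε.num.natAbs ε.den : ℕ) : ℝ) := by
    have : 1 ≤ max ε.num.natAbs ε.den := le_max_of_le_right ε.den_pos
    exact_mod_cast this
  exact Real.log_le_log hpos hmax

/-! ### The decomposition `y = ε · w³` -/

/-- **`𝒪^×` modulo cubes** (the step "`y = ε y'³`" of the proof of Cor. 9.1, symmetric exponents): every
`y ∈ 𝒪^× = ℤ[1/N_S]^×` is `ε · w³` with `ε, w ∈ 𝒪^×` and `h(ε) ≤ log N_S` (`ord_p(ε) ∈ {−1, 0, 1}` for `p ∈ S`;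
`w = ∏_{p ∈ S} p^{q_p}` with `ord_p(y) = 3q_p + r_p`, `ε = y/w³`).
[cite: VonkanelMatschke2023, §9 (proof of Cor. 9.1: y = ε y'³)] -/
theorem exists_eq_mul_cube_of_isSUnit {S : Finset ℕ} (hS : ∀ p ∈ S, p.Prime) {y : ℚ} (hy : IsSUnit S y) :
    ∃ ε w : ℚ, IsSUnit S ε ∧ IsSUnit S w ∧ y = ε * w ^ 3 ∧ logHeight₁ ε ≤ Real.log (primesProd S) := by
  have hy0 : y ≠ 0 := hy.1
  -- exponents: `ord_p(y) = 3 q_p + r_p`, `r_p ∈ {−1, 0, 1}`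
  set q : ℕ → ℤ := fun p => (padicValRat p y + 1) / 3 with hq
  set w : ℚ := ∏ ℓ ∈ S, (ℓ : ℚ) ^ q ℓ with hw
  have hw0 : w ≠ 0 :=
    Finset.prod_ne_zero_iff.mpr fun ℓ hℓ => zpow_ne_zero _ (by exact_mod_cast (hS ℓ hℓ).ne_zero)
  have hvw : ∀ p : ℕ, p.Prime → padicValRat p w = if p ∈ S then q p else 0 := by
    intro p hp
    haveI : Fact p.Prime := ⟨hp⟩
    exact padicValRat_prod_natCast_zpow hS q p
  have hwS : IsSUnit S w := isSUnit_of_padicValRat_eq_zero hw0 fun p hp hpS => by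
    rw [hvw p hp, if_neg hpS]
  set ε : ℚ := y / w ^ 3 with hε
  have hε0 : ε ≠ 0 := div_ne_zero hy0 (pow_ne_zero 3 hw0)
  have hvε : ∀ p : ℕ, p.Prime → padicValRat p ε = padicValRat p y - 3 * padicValRat p w := by
    intro p hp
    haveI : Fact p.Prime := ⟨hp⟩
    rw [hε, padicValRat.div hy0 (pow_ne_zero 3 hw0), padicValRat.pow]
    push_cast; ring
  have hεS : IsSUnit S ε := isSUnit_of_padicValRat_eq_zero hε0 fun p hp hpS => by
    rw [hvε p hp, hvw p hp, if_neg hpS, padicValRat_eq_zero_of_isSUnit hy hp hpS]; ring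
  have hr : ∀ p ∈ S, padicValRat p ε ≤ 1 ∧ -1 ≤ padicValRat p ε := by
    intro p hp
    have hpP := hS p hp
    rw [hvε p hpP, hvw p hpP, if_pos hp, hq]
    dsimp only
    have := Int.emod_add_mul_ediv (padicValRat p y + 1) 3
    have h0 := Int.emod_nonneg (padicValRat p y + 1) (by norm_num : (3 : ℤ) ≠ 0)
    have h3 := Int.emod_lt_of_pos (padicValRat p y + 1) (by norm_num : (0 : ℤ) < 3)
    constructor <;> omega
  refine ⟨ε, w, hεS, hwS, ?_, logHeight₁_le_log_primesProd hS hεS (fun p hp => (hr p hp).1)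
    (fun p hp => (hr p hp).2)⟩
  rw [hε]; field_simp

end VonKanelMatschke

end Literature.NumberTheory.DiophantineGeometry

end
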